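import Summits.CriticalPhenomena.PercolationContinuityZ3.Theorems.PercNearOneGluingNoHeavyLowerTailQuantitativeBHKRepulsion
import Literature.Probability.Percolation.KozmaNitzanPreFKG
import HarnessLib

/-!
# Level-0 CSH margin with BOTH discarded terms floored (Harris term + repulsion deletion floor)

Support file (`--supports stmt-CriticalPhenomena-4575`), prover seat `prim-rate-mine-2` (lane prim-rate, constants-miner (c), BENCH row
M2-R12; `run/shared/lean/prim/prim-rate/prim-rate-mine-2/CANDIDATES.md` §gen-2).  No definitions, no named facts, no sorries; standard axioms.
DRAFT — per lane Ruling 15 this connection-form file is proposed only after mine-ref's ATTACKED-CLEAN on rows M2-R10/R11 (it imports p311987).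

The (K6) transfer behind paper Lemma 3.8 (`CSH.covTransfer_relaySet_edge`) for a single relay `x` and the connection functional `1{x↔b}` is the
exact identity `μ(D)·Cov_{O_x} − μ(D∩O_v)·Cov_Q = μ(D)·Cov_U + R` with the van den Berg–Häggström–Kahn repulsion slack `R ≥ 0`.  Gen 1 kept the
Harris term `Cov_U` (`CSH.covTransfer_relaySet_edge_harrisFloor`, p307130); here the slack `R` is kept as well and floored by the deletion floor
(`QuantBHK.twoCluster_repulsion_openConn_ge_deletion`): `QuantBHK.level0Margin_ge_harris_add_deletion`.
[cite: VandenbergHaggstromKahn2005, Thm. 1.4 (p. 7)] [cite: Harris1960, Lemma 4.1 (p. 16)]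
-/

noncomputable section

namespace Summit.CriticalPhenomena.PercolationContinuityZ3.Theorems

open MeasureTheory Set Literature.Probability.LatticeModels Literature.Probability.Percolation
open scoped Classical

namespace QuantBHK

universe v

variable {V : Type v} [Fintype V]

/-- **Level-0 CSH margin with BOTH discarded terms floored (connection functional, single relay).**  `x, b, o, v` vertices, `x ≠ v`;
`D = {x ↮ v}`, `B = {x ↔ b}`, `Q = {v ↔ x}`, `O_x = {o ↔ x}`, `O_v = {o ↔ v}`, `U = O_x ∪ O_v`, `m = μ(B)`.  The (K6) transfer of paper Lemma 3.8
(`CSH.covTransfer_relaySet_edge`) reads `μ(D)·Cov_{O_x}(1_B) − μ(D∩O_v)·Cov_Q(1_B) = μ(D)·Cov_U(1_B) + R`, `R = μ(D∩O_v)μ(D∩B) − μ(D)μ(D∩O_v∩B)`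
(the vdBHK repulsion slack, ≥ 0); here the slack is KEPT and floored by the deletion floor `twoCluster_repulsion_openConn_ge_deletion`:
  `μ(D∩O_v)(μ(Q∩B) − μ(Q)m) + μ(D)(μ(U∩B) − μ(U)m) + μ(D∩B)·∫_D (P_{C_x}(v↔o) − P_{C_x,b}(v↔o)) dμ ≤ μ(D)(μ(O_x∩B) − μ(O_x)m)`
— the first extra term is the HARRIS term (row M2-R5, itself ≥ the joint-pivotality floor of `CSH.covTransfer_relaySet_edge_explicitFloor`), the second the
REPULSION floor (row M2-R11); BENCH row M2-R12 of the prim-rate lane.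
[cite: VandenbergHaggstromKahn2005, Thm. 1.4 (p. 7)] [cite: Harris1960, Lemma 4.1 (p. 16)] -/
theorem level0Margin_ge_harris_add_deletion (w : Sym2 V → unitInterval) (x b o v : V) (hxv : x ≠ v) :
    (prodBernoulli w).real ({ω : BondConfig V | ¬ (openGraph ω).Reachable x v} ∩ openConn o v) *
          ((prodBernoulli w).real (openConn v x ∩ openConn x b) -
            (prodBernoulli w).real (openConn v x) * (prodBernoulli w).real (openConn x b)) +
        (prodBernoulli w).real {ω : BondConfig V | ¬ (openGraph ω).Reachable x v} *
          ((prodBernoulli w).real ((openConn o x ∪ openConn o v) ∩ openConn x b) -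
            (prodBernoulli w).real (openConn o x ∪ openConn o v) * (prodBernoulli w).real (openConn x b)) +
        (prodBernoulli w).real ({ω : BondConfig V | ¬ (openGraph ω).Reachable x v} ∩ openConn x b) *
          (∫ ω in {ω : BondConfig V | ¬ (openGraph ω).Reachable x v},
            ((prodBernoulli w).real {η : BondConfig V |
                (openGraph (η \ {e | ∃ z ∈ e, z ∈ openCluster ω x})).Reachable v o} -
              (prodBernoulli w).real {η : BondConfig V |
                (openGraph (η \ {e | ∃ z ∈ e, z ∈ openCluster ω x ∨ z = b})).Reachable v o}) ∂(prodBernoulli w)) ≤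
      (prodBernoulli w).real {ω : BondConfig V | ¬ (openGraph ω).Reachable x v} *
        ((prodBernoulli w).real (openConn o x ∩ openConn x b) -
          (prodBernoulli w).real (openConn o x) * (prodBernoulli w).real (openConn x b)) := by
  set μ := prodBernoulli w with hμ
  have hmeas : ∀ T : Set (BondConfig V), MeasurableSet T := fun _ => MeasurableSet.of_discrete
  have hn := fun (T : Set (BondConfig V)) => (measureReal_nonneg : 0 ≤ μ.real T)
  set D : Set (BondConfig V) := {ω : BondConfig V | ¬ (openGraph ω).Reachable x v} with hD
  set B : Set (BondConfig V) := openConn x b with hB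
  set Q : Set (BondConfig V) := openConn v x with hQ
  set Ox : Set (BondConfig V) := openConn o x with hOx
  set Ov : Set (BondConfig V) := openConn o v with hOv
  -- the repulsion slack, floored
  have hrep := twoCluster_repulsion_openConn_ge_deletion w x v b o hxv
  have hvo : (openConn v o : Set (BondConfig V)) = Ov := by rw [hOv, KNPreFKG.openConn_symm]
  rw [← hμ, ← hD, ← hB, hvo] at hrep
  have hDBO : D ∩ B ∩ Ov = D ∩ Ov ∩ B := by
    rw [Set.inter_assoc, Set.inter_comm B Ov, ← Set.inter_assoc]
  rw [hDBO] at hrep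
  -- `U = O_x ⊔ (D ∩ O_v)` and `D = Qᶜ`
  have hUdiff : (Ox ∪ Ov) \ Ox = D ∩ Ov := by
    ext ω
    simp only [hOx, hOv, hD, mem_sdiff, mem_union, mem_inter_iff, openConn, mem_setOf_eq]
    constructor
    · rintro ⟨h | h, hno⟩
      · exact absurd h hno
      · exact ⟨fun hxv' => hno (h.trans hxv'.symm), h⟩
    · rintro ⟨hd, hov⟩
      exact ⟨Or.inr hov, fun hox => hd (hox.symm.trans hov)⟩
  have hUμ : μ.real (Ox ∪ Ov) = μ.real Ox + μ.real (D ∩ Ov) := by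
    rw [← measureReal_inter_add_sdiff (s := Ox ∪ Ov) (h := measure_ne_top _ _) (hmeas Ox), inter_eq_right.2 subset_union_left, hUdiff]
  have hUBμ : μ.real ((Ox ∪ Ov) ∩ B) = μ.real (Ox ∩ B) + μ.real (D ∩ Ov ∩ B) := by
    have h1 : ((Ox ∪ Ov) ∩ B) ∩ Ox = Ox ∩ B := by
      ext ω; simp only [mem_inter_iff, mem_union]; tauto
    have h2 : ((Ox ∪ Ov) ∩ B) \ Ox = D ∩ Ov ∩ B := by
      rw [← hUdiff]; ext ω; simp only [mem_inter_iff, mem_sdiff, mem_union]; tauto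
    rw [← measureReal_inter_add_sdiff (s := (Ox ∪ Ov) ∩ B) (h := measure_ne_top _ _) (hmeas Ox), h1, h2]
  have hDQ : D = Qᶜ := by
    ext ω
    simp only [hD, hQ, openConn, mem_compl_iff, mem_setOf_eq]
    exact ⟨fun h h' => h h'.symm, fun h h' => h h'.symm⟩
  have hDμ : μ.real D = 1 - μ.real Q := by
    have h1 : μ.real (univ : Set (BondConfig V)) = μ.real (univ ∩ Q) + μ.real (univ \ Q) :=
      (measureReal_inter_add_sdiff (s := univ) (h := measure_ne_top _ _) (hmeas Q)).symm
    rw [probReal_univ, univ_inter, ← compl_eq_univ_sdiff, ← hDQ] at h1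
    linarith
  have hDBμ : μ.real (D ∩ B) = μ.real B - μ.real (Q ∩ B) := by
    have h1 : μ.real B = μ.real (B ∩ Q) + μ.real (B \ Q) :=
      (measureReal_inter_add_sdiff (s := B) (h := measure_ne_top _ _) (hmeas Q)).symm
    have h2 : B \ Q = D ∩ B := by
      rw [hDQ]; ext ω; simp only [mem_sdiff, mem_inter_iff, mem_compl_iff]; tauto
    rw [Set.inter_comm B Q, h2] at h1
    linarith
  -- assemble (exact bookkeeping + the floored slack `hrep`)
  rw [hUμ, hUBμ, hDBμ]
  rw [hDBμ] at hrep
  rw [hDμ] at hrep ⊢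
  linarith [hrep]

end QuantBHK

end Summit.CriticalPhenomena.PercolationContinuityZ3.Theorems
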